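import Summits.FinalStateConjecture.FinalStateConjecture.Theorems.KerrnessPropagatesKillingSpinorEndgameWhiteHoleSector

/-!
# The orthochronous sector split of `KillingSpinorEndgame`
# (crux stmt-FinalStateConjecture-17645, route `KerrnessPropagates`; the LOGICAL SHAPE of the filed crux,
# kernel-checked form of the sixth lead's reshape of line `registered`)

Clause (i) of `Theses.KerrnessPropagates.KillingSpinorEndgame` hands the endgame a recurrence configuration
`p = (N; Mᵢ, aᵢ, r₀ᵢ; Λᵢ, cᵢ)` with `Λᵢ` in the FULL Lorentz group `O(1,3)`; it does not ask the motions to be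
orthochronous (finding F2, p146528), and for `Λᵢ = Λ₀·T` the reference `boostedKerrBilin Λᵢ cᵢ Mᵢ aᵢ` is the
OUTGOING (white-hole) Kerr–Schild form (`kerr_bilin_timeReversal_eq_outgoing`, p161997). Every proof of the filed
text must therefore decide the case `∀ i, IsOrthochronous (mo i).1`. This file records that case split as
theorems about the crux BY NAME:

* `killingSpinorEndgame_iff_sectors` — the filed crux is EQUIVALENT to the conjunction of
  (O) its ORTHOCHRONOUS SECTOR: "there is a `k` such that recurrence at regularity `k` (p152635's `SlabClauses`,
      the filed block verbatim) to an orthochronous sub-extremal horizon-penetrating configuration forces an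
      honest exterior decomposition (sub-extremal holes, `O = exteriorOf`, `HasExhaustiveCharts`,
      `IsFutureOriented`)" — this is the planners' candidate restatement `KillingSpinorEndgameOrtho` of
      `Cruxes/KillingSpinorEndgame/Lines/registered_restated_c3.lean`, written without its waypoint names — and
  (W) its WHITE-HOLE SECTOR: the same with SOME motion non-orthochronous.
  (`→`: both sectors at the crux's own `k`, the interior-lemma hypothesis (ii) being idle,
  `killingSpinorEndgame_iff_honest` p158979; `←`: `k := max k_O k_W`, recurrence is antitone in `k`,
  `SlabClauses.anti`, then cases.) So restating the crux as (O) discards exactly (W) and nothing else.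
* `whiteHole_settles_of_whiteHoleSector` — (W) alone already contains the `ε`-free, lateness-free,
  smallness-free POINTWISE final-state assertion of p161997: every admissible MGHD with complete `𝓘⁺` carrying
  ONE exact outgoing Schwarzschild slab `{x⁰ = τ, ‖x̲ − c̲‖ > r₀}`, `0 < r₀ < 2M` (straddling the white-hole
  horizon), achronal, in `J⁺(ιX)`, `∂₀` future-directed far out, settles honestly into sub-extremal BLACK holes.
  (W) is thus not smaller than the summit on an open data sector and is addressed by none of the route's
  perturbative engines; it is the registered stub `stub_whiteHoleSector` of line `registered`
  (`Cruxes/KillingSpinorEndgame/Lines/registered.lean`), handed back to the planner to be CUT, not proved.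

Pure logic over the route file and p152635/p158979/p161997; the crux is not claimed false.
References: Theses/KerrnessPropagates.lean (stmt-17645); O'Neill 1983, Ch. 9, pp. 233–236 (`O(1,3)`, `O⁺(1,3)`);
Kerr–Schild 1965, §2 (the discrete element `T` on the ansatz); DHRT arXiv:2104.08222, §1 (`Cᵏ` vocabulary).
-/

open Literature.Geometry.Lorentzian
open scoped Manifold ContDiff Topology ENNReal
open Filter Set TopologicalSpace Function

-- `FinalStateConjecture.FinalStateConjecture` repeats summit = sub-problem (D-0017); deliberate.
set_option linter.dupNamespace false

noncomputable section

namespace Summit.FinalStateConjecture.FinalStateConjecture.Theorems.KerrnessPropagates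

open Summit.FinalStateConjecture.FinalStateConjecture.Theses.KerrnessPropagates
open Summit.FinalStateConjecture.FinalStateConjecture.Theorems.TameCensorship.Negative
open Summit.FinalStateConjecture.FinalStateConjecture.Theorems.KerrBasinCapture.Negative

/-! ### The sector split -/

/-- **`KillingSpinorEndgame` ↔ (orthochronous sector) ∧ (white-hole sector).** The filed crux is equivalent
to the conjunction of (O) "some regularity `k` makes recurrence (`SlabClauses`, filed block verbatim) to an
ORTHOCHRONOUS sub-extremal horizon-penetrating configuration force an honest exterior decomposition" and
(W) the same for configurations with SOME non-orthochronous motion. Forward: both at the crux's own `k`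
(hypothesis (ii) idle, `killingSpinorEndgame_iff_honest`). Backward: `k := max k_O k_W`, recurrence being
antitone in the regularity (`SlabClauses.anti`), then the case split `∀ i, IsOrthochronous (mo i).1`.
O'Neill 1983, Ch. 9, pp. 233–236 (`O(1,3) = O⁺(1,3) ⊔ O⁺(1,3)·T`). [cite: ONeill1983, Ch. 9 pp. 233–236] -/
theorem killingSpinorEndgame_iff_sectors :
    KillingSpinorEndgame ↔
    ((∃ k : ℕ, ∀ (X : Type) [TopologicalSpace X] [ChartedSpace E3 X] [IsManifold (𝓡 3) ∞ X]
        [T2Space X] [SecondCountableTopology X] [ConnectedSpace X] (D : InitialDataSet (𝓡 3) X),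
        D ∈ admissibleVacuumData X → ∀ 𝒟 : VacuumCauchyDevelopment D, 𝒟.IsMaximal →
        Summit.FinalStateConjecture.HasCompleteNullInfinity 𝒟.toCauchyDevelopment →
        ∀ (N : ℕ) (M a r₀ : Fin N → ℝ) (mo : Fin N → ↥lorentzGroup × E4),
        (∀ i, Kerr.IsSubextremal (M i) (a i) ∧
          r₀ i ∈ Ioo (Kerr.rMinus (M i) (a i)) (Kerr.rPlus (M i) (a i)) ∧
          Summit.FinalStateConjecture.IsOrthochronous (mo i).1) →
        (∀ ε : ℝ, 0 < ε → ∀ τ₁ : ℝ, ∃ τ : ℝ, τ₁ ≤ τ ∧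
          ∃ (R : Fin N → ℝ) (U : Opens E4) (Φ : U → 𝒟.carrier),
            SlabClauses 𝒟 k N M a r₀ mo ε τ R U Φ) →
        ∃ (O : Set 𝒟.carrier) (d : FinalStateDecomposition 𝒟.toSpacetime O 2),
          (∀ i, Kerr.IsSubextremal (d.mass i) (d.spin i)) ∧
          O = Summit.FinalStateConjecture.exteriorOf 𝒟.toCauchyDevelopment d.charted ∧
          Summit.FinalStateConjecture.HasExhaustiveCharts d ∧
          Summit.FinalStateConjecture.IsFutureOriented d) ∧
     (∃ k : ℕ, ∀ (X : Type) [TopologicalSpace X] [ChartedSpace E3 X] [IsManifold (𝓡 3) ∞ X]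
        [T2Space X] [SecondCountableTopology X] [ConnectedSpace X] (D : InitialDataSet (𝓡 3) X),
        D ∈ admissibleVacuumData X → ∀ 𝒟 : VacuumCauchyDevelopment D, 𝒟.IsMaximal →
        Summit.FinalStateConjecture.HasCompleteNullInfinity 𝒟.toCauchyDevelopment →
        ∀ (N : ℕ) (M a r₀ : Fin N → ℝ) (mo : Fin N → ↥lorentzGroup × E4),
        (∀ i, Kerr.IsSubextremal (M i) (a i) ∧
          r₀ i ∈ Ioo (Kerr.rMinus (M i) (a i)) (Kerr.rPlus (M i) (a i))) →
        (∃ i, ¬ Summit.FinalStateConjecture.IsOrthochronous (mo i).1) →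
        (∀ ε : ℝ, 0 < ε → ∀ τ₁ : ℝ, ∃ τ : ℝ, τ₁ ≤ τ ∧
          ∃ (R : Fin N → ℝ) (U : Opens E4) (Φ : U → 𝒟.carrier),
            SlabClauses 𝒟 k N M a r₀ mo ε τ R U Φ) →
        ∃ (O : Set 𝒟.carrier) (d : FinalStateDecomposition 𝒟.toSpacetime O 2),
          (∀ i, Kerr.IsSubextremal (d.mass i) (d.spin i)) ∧
          O = Summit.FinalStateConjecture.exteriorOf 𝒟.toCauchyDevelopment d.charted ∧
          Summit.FinalStateConjecture.HasExhaustiveCharts d ∧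
          Summit.FinalStateConjecture.IsFutureOriented d)) := by
  rw [killingSpinorEndgame_iff_honest]
  constructor
  · rintro ⟨k, hk⟩
    refine ⟨⟨k, fun X _ _ _ _ _ _ D hD 𝒟 hmax hscri N M a r₀ mo hcfg hrec ↦ ?_⟩,
      ⟨k, fun X _ _ _ _ _ _ D hD 𝒟 hmax hscri N M a r₀ mo hsub _ hrec ↦ ?_⟩⟩
    · exact hk X D hD 𝒟 hmax hscri ⟨N, M, a, r₀, mo, fun i ↦ ⟨(hcfg i).1, (hcfg i).2.1⟩, hrec⟩
    · exact hk X D hD 𝒟 hmax hscri ⟨N, M, a, r₀, mo, hsub, hrec⟩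
  · rintro ⟨⟨k₁, hk₁⟩, ⟨k₂, hk₂⟩⟩
    refine ⟨max k₁ k₂, fun X _ _ _ _ _ _ D hD 𝒟 hmax hscri hrec ↦ ?_⟩
    obtain ⟨N, M, a, r₀, mo, hsub, hrec⟩ := hrec
    have hanti : ∀ {k : ℕ}, k ≤ max k₁ k₂ →
        ∀ ε : ℝ, 0 < ε → ∀ τ₁ : ℝ, ∃ τ : ℝ, τ₁ ≤ τ ∧
          ∃ (R : Fin N → ℝ) (U : Opens E4) (Φ : U → 𝒟.carrier),
            SlabClauses 𝒟 k N M a r₀ mo ε τ R U Φ := by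
      intro k hk ε hε τ₁
      obtain ⟨τ, hτ, R, U, Φ, hs⟩ := hrec ε hε τ₁
      exact ⟨τ, hτ, R, U, Φ, hs.anti hk⟩
    by_cases hortho : ∀ i, Summit.FinalStateConjecture.IsOrthochronous (mo i).1
    · exact hk₁ X D hD 𝒟 hmax hscri N M a r₀ mo (fun i ↦ ⟨(hsub i).1, (hsub i).2, hortho i⟩)
        (hanti (le_max_left k₁ k₂))
    · push Not at hortho
      exact hk₂ X D hD 𝒟 hmax hscri N M a r₀ mo hsub hortho (hanti (le_max_right k₁ k₂))

/-- **The filed crux contains its white-hole sector** (the `→` half of `killingSpinorEndgame_iff_sectors`,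
isolated for citation): if `KillingSpinorEndgame` holds then some regularity `k` makes recurrence to every
sub-extremal horizon-penetrating configuration with SOME non-orthochronous motion force an honest exterior
decomposition. [folklore] -/
theorem whiteHoleSector_of_killingSpinorEndgame (hE : KillingSpinorEndgame) :
    ∃ k : ℕ, ∀ (X : Type) [TopologicalSpace X] [ChartedSpace E3 X] [IsManifold (𝓡 3) ∞ X]
      [T2Space X] [SecondCountableTopology X] [ConnectedSpace X] (D : InitialDataSet (𝓡 3) X),
      D ∈ admissibleVacuumData X → ∀ 𝒟 : VacuumCauchyDevelopment D, 𝒟.IsMaximal →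
      Summit.FinalStateConjecture.HasCompleteNullInfinity 𝒟.toCauchyDevelopment →
      ∀ (N : ℕ) (M a r₀ : Fin N → ℝ) (mo : Fin N → ↥lorentzGroup × E4),
      (∀ i, Kerr.IsSubextremal (M i) (a i) ∧
        r₀ i ∈ Ioo (Kerr.rMinus (M i) (a i)) (Kerr.rPlus (M i) (a i))) →
      (∃ i, ¬ Summit.FinalStateConjecture.IsOrthochronous (mo i).1) →
      (∀ ε : ℝ, 0 < ε → ∀ τ₁ : ℝ, ∃ τ : ℝ, τ₁ ≤ τ ∧
        ∃ (R : Fin N → ℝ) (U : Opens E4) (Φ : U → 𝒟.carrier),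
          SlabClauses 𝒟 k N M a r₀ mo ε τ R U Φ) →
      ∃ (O : Set 𝒟.carrier) (d : FinalStateDecomposition 𝒟.toSpacetime O 2),
        (∀ i, Kerr.IsSubextremal (d.mass i) (d.spin i)) ∧
        O = Summit.FinalStateConjecture.exteriorOf 𝒟.toCauchyDevelopment d.charted ∧
        Summit.FinalStateConjecture.HasExhaustiveCharts d ∧
        Summit.FinalStateConjecture.IsFutureOriented d :=
  (killingSpinorEndgame_iff_sectors.1 hE).2

/-! ### What the white-hole sector alone demands -/

/-- **The white-hole sector alone contains the exact-outgoing-slab endgame.** Suppose only the WHITE-HOLE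
SECTOR (W) of the crux: some regularity `k` makes recurrence to every sub-extremal horizon-penetrating
configuration with some non-orthochronous motion force an honest exterior. Then every admissible MGHD with
complete `𝓘⁺` containing ONE exact OUTGOING (white-hole) Eddington–Finkelstein/Kerr–Schild Schwarzschild slab —
mass `M > 0`, centre `c`, depth `r₀ ∈ (0, 2M)` (the punctured hyperplane `{x⁰ = τ, ‖x̲ − c̲‖ > r₀}` straddles
the past horizon `‖x̲ − c̲‖ = 2M`); a smooth open embedding `Φ` of a neighbourhood `U` of it with achronal leaf,
`range Φ ⊆ J⁺(ιX)`, `Φ_*∂₀` future-directed beyond some radius, and on `U`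
`g(dΦ v, dΦ w) = η(v, w) + (2M/r)(v⁰ − (z̲·v̲)/r)(w⁰ − (z̲·w̲)/r)`, `z = x − c`, `r = ‖z̲‖` — admits an honest
exterior decomposition into sub-extremal Kerr BLACK holes. Proof: the outgoing form is `boostedKerrBilin T c M 0`
(`kerr_bilin_timeReversal_eq_outgoing`, `boostedKerrBilin_timeReversal_apply`), `T` is a legal and
NON-orthochronous motion (`not_isOrthochronous_timeReversalLorentz`), `(M, 0)` is sub-extremal with
`(r₋, r₊) = (0, 2M)`, and one exact slab recurs at every regularity (`recurs_of_exact`: lateness idle, p152635;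
far-field decay, `BoostedKerrSchildDecay`). The premise is `ε`-free, lateness-free and smallness-free and
concerns an EARLY region; (W) is thus the pointwise large-data final-state assertion for white-hole-emergent
admissible data — the content a restatement with `IsOrthochronous (mo i).1` removes. [cite: KerrSchild1965, §2] -/
theorem whiteHole_settles_of_whiteHoleSector
    (hW : ∃ k : ℕ, ∀ (X : Type) [TopologicalSpace X] [ChartedSpace E3 X] [IsManifold (𝓡 3) ∞ X]
      [T2Space X] [SecondCountableTopology X] [ConnectedSpace X] (D : InitialDataSet (𝓡 3) X),
      D ∈ admissibleVacuumData X → ∀ 𝒟 : VacuumCauchyDevelopment D, 𝒟.IsMaximal →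
      Summit.FinalStateConjecture.HasCompleteNullInfinity 𝒟.toCauchyDevelopment →
      ∀ (N : ℕ) (M a r₀ : Fin N → ℝ) (mo : Fin N → ↥lorentzGroup × E4),
      (∀ i, Kerr.IsSubextremal (M i) (a i) ∧
        r₀ i ∈ Ioo (Kerr.rMinus (M i) (a i)) (Kerr.rPlus (M i) (a i))) →
      (∃ i, ¬ Summit.FinalStateConjecture.IsOrthochronous (mo i).1) →
      (∀ ε : ℝ, 0 < ε → ∀ τ₁ : ℝ, ∃ τ : ℝ, τ₁ ≤ τ ∧
        ∃ (R : Fin N → ℝ) (U : Opens E4) (Φ : U → 𝒟.carrier),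
          SlabClauses 𝒟 k N M a r₀ mo ε τ R U Φ) →
      ∃ (O : Set 𝒟.carrier) (d : FinalStateDecomposition 𝒟.toSpacetime O 2),
        (∀ i, Kerr.IsSubextremal (d.mass i) (d.spin i)) ∧
        O = Summit.FinalStateConjecture.exteriorOf 𝒟.toCauchyDevelopment d.charted ∧
        Summit.FinalStateConjecture.HasExhaustiveCharts d ∧
        Summit.FinalStateConjecture.IsFutureOriented d) :
    ∀ (X : Type) [TopologicalSpace X] [ChartedSpace E3 X] [IsManifold (𝓡 3) ∞ X]
      [T2Space X] [SecondCountableTopology X] [ConnectedSpace X] (D : InitialDataSet (𝓡 3) X),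
      D ∈ admissibleVacuumData X → ∀ 𝒟 : VacuumCauchyDevelopment D, 𝒟.IsMaximal →
      Summit.FinalStateConjecture.HasCompleteNullInfinity 𝒟.toCauchyDevelopment →
      ∀ (M r₀ : ℝ) (c : E4), 0 < M → r₀ ∈ Ioo 0 (2 * M) →
      ∀ (U : Opens E4) (Φ : U → 𝒟.carrier) (τ : ℝ),
      ContMDiff 𝓘(ℝ, E4) (𝓡 4) ∞ Φ → Topology.IsOpenEmbedding Φ →
      {x : E4 | x 0 = τ ∧ r₀ < E4.spatialNorm (x - c)} ⊆ (U : Set E4) →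
      range Φ ⊆ 𝒟.metric.causalFuture 𝒟.timeOrientation (range 𝒟.embed) →
      𝒟.metric.IsAchronal 𝒟.timeOrientation (Φ '' {x : ↥U | (x : E4) 0 = τ}) →
      (∀ (x : ↥U) (v w : E4),
        𝒟.metric.val (Φ x) (mfderiv 𝓘(ℝ, E4) (𝓡 4) Φ x v) (mfderiv 𝓘(ℝ, E4) (𝓡 4) Φ x w) =
          Minkowski.bilin v w + 2 * (M / E4.spatialNorm ((x : E4) - c)) *
            ((v 0 - (((x : E4) - c) 1 * v 1 + ((x : E4) - c) 2 * v 2 + ((x : E4) - c) 3 * v 3) /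
                E4.spatialNorm ((x : E4) - c)) *
             (w 0 - (((x : E4) - c) 1 * w 1 + ((x : E4) - c) 2 * w 2 + ((x : E4) - c) 3 * w 3) /
                E4.spatialNorm ((x : E4) - c)))) →
      (∃ ρ : ℝ, ∀ x : ↥U, (x : E4) 0 = τ → ρ ≤ E4.spatialNorm ((x : E4) - c) →
        𝒟.timeOrientation.IsFutureDirected (mfderiv 𝓘(ℝ, E4) (𝓡 4) Φ x (E4.basisVector 0))) →
      ∃ (O : Set 𝒟.carrier) (d : FinalStateDecomposition 𝒟.toSpacetime O 2),
        (∀ i, Kerr.IsSubextremal (d.mass i) (d.spin i)) ∧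
        O = Summit.FinalStateConjecture.exteriorOf 𝒟.toCauchyDevelopment d.charted ∧
        Summit.FinalStateConjecture.HasExhaustiveCharts d ∧
        Summit.FinalStateConjecture.IsFutureOriented d := by
  obtain ⟨k, hk⟩ := hW
  intro X _ _ _ _ _ _ D hD 𝒟 hmax hscri M r₀ c hM hr₀ U Φ τ hsm hemb hU hJ hachr hexact horient
  have hsub : Kerr.IsSubextremal M 0 := by
    change |(0 : ℝ)| < M
    rwa [abs_zero]
  have hrm : Kerr.rMinus M 0 = 0 := by simp [Kerr.rMinus, Real.sqrt_sq hM.le]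
  have hr₀' : r₀ ∈ Ioo (Kerr.rMinus M 0) (Kerr.rPlus M 0) := by
    rwa [hrm, Kerr.rPlus_zero_right hM.le]
  have hU' : {x : E4 | x 0 = τ ∧ r₀ < Kerr.radius 0 (poincareInv timeReversalLorentz c x)} ⊆
      (U : Set E4) := by
    rintro x ⟨hx0, hxr⟩
    rw [radius_poincareInv_timeReversal] at hxr
    exact hU ⟨hx0, hxr⟩
  have horient' : ∃ ρ : ℝ, ∀ x : ↥U, (x : E4) 0 = τ →
      ρ ≤ Kerr.radius 0 (poincareInv timeReversalLorentz c x) →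
      𝒟.timeOrientation.IsFutureDirected (mfderiv 𝓘(ℝ, E4) (𝓡 4) Φ x (E4.basisVector 0)) := by
    obtain ⟨ρ, hρ⟩ := horient
    refine ⟨ρ, fun x hx0 hxr ↦ hρ x hx0 ?_⟩
    rwa [radius_poincareInv_timeReversal] at hxr
  have hexact' : ∀ (x : ↥U) (v w : E4),
      𝒟.metric.val (Φ x) (mfderiv 𝓘(ℝ, E4) (𝓡 4) Φ x v) (mfderiv 𝓘(ℝ, E4) (𝓡 4) Φ x w) =
        boostedKerrBilin timeReversalLorentz c M 0 x v w := by
    intro x v w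
    rw [hexact, boostedKerrBilin_timeReversal_apply, kerr_bilin_timeReversal_eq_outgoing]
  exact hk X D hD 𝒟 hmax hscri 1 (fun _ ↦ M) (fun _ ↦ 0) (fun _ ↦ r₀) (fun _ ↦ (timeReversalLorentz, c))
    (fun _ ↦ ⟨hsub, hr₀'⟩) ⟨0, not_isOrthochronous_timeReversalLorentz⟩
    (recurs_of_exact 𝒟 k M 0 r₀ timeReversalLorentz c hsm hemb hU' hJ hachr hexact' horient')

end Summit.FinalStateConjecture.FinalStateConjecture.Theorems.KerrnessPropagates

end
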